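import Mathlib

/-!
# Positive association from a monotone Gibbs sampler — the abstract finite lemma (blind cell
PercRepro2, p3 g12, 2026-08-27; `proofs/P3-G2.md` §3, steps 1–4)

Let `q` be a probability vector on a finite type `S`, `T` a stochastic kernel on `S` all of whose
entries are at least `δ > 0`, and `Inc` a class of functions closed under `T` on which one Gibbs
step does not increase the covariance: `cov q (T g₁) (T g₂) ≤ cov q g₁ g₂`.  Then every two
functions of the class are positively correlated under `q` (`cov_nonneg_of_gibbs`).

Proof: iterate the step (`cov q (T^[n] g₁) (T^[n] g₂) ≤ cov q g₁ g₂`), bound a covariance by the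
product of the oscillations (`neg_mul_osc_le_cov`), and contract the oscillation by the Doeblin
factor `ρ = 1 − δ·|S| < 1` at every step (`osc_kap`); `ρ^(2n)` tends to `0`.  Own work; standard
axioms; `Mathlib` only.  The percolation instantiation (`P3-G2.md` §2) is separate.
-/

namespace Summit.Ventures.PercRepro2

namespace GibbsPA

open Finset

variable {S : Type*} [Fintype S]

/-- The covariance of `f` and `g` under the weights `q`. -/
def cov (q f g : S → ℝ) : ℝ :=
  (∑ s, q s * (f s * g s)) - (∑ s, q s * f s) * (∑ s, q s * g s)

/-- The kernel `T` applied to `g`: `(kap T g) s = ∑ u, T s u * g u`. -/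
def kap (T : S → S → ℝ) (g : S → ℝ) : S → ℝ := fun s => ∑ u, T s u * g u

/-- `Osc h M`: every difference of two values of `h` is at most `M`. -/
def Osc (h : S → ℝ) (M : ℝ) : Prop := ∀ s s', h s - h s' ≤ M

/-- Centring: under a probability vector the covariance is the weighted sum of the products of the
centred values. -/
theorem cov_eq_centered (q f g : S → ℝ) (hq1 : ∑ s, q s = 1) :
    cov q f g = ∑ s, q s * ((f s - ∑ u, q u * f u) * (g s - ∑ u, q u * g u)) := by
  unfold cov
  set mf := ∑ u, q u * f u with hmf
  set mg := ∑ u, q u * g u with hmg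
  have h1 : ∑ s, q s * ((f s - mf) * (g s - mg)) =
      ∑ s, (q s * (f s * g s) - mg * (q s * f s) - mf * (q s * g s) + (mf * mg) * q s) := by
    apply Finset.sum_congr rfl
    intro s _
    ring
  rw [h1, Finset.sum_add_distrib, Finset.sum_sub_distrib, Finset.sum_sub_distrib,
    ← Finset.mul_sum, ← Finset.mul_sum, ← Finset.mul_sum, hq1]
  rw [← hmf, ← hmg]
  ring

/-- A value of `h` differs from its `q`-mean by at most the oscillation bound. -/
theorem abs_sub_mean_le {h : S → ℝ} {M : ℝ} (hM : Osc h M) (q : S → ℝ) (hq0 : ∀ s, 0 ≤ q s)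
    (hq1 : ∑ s, q s = 1) (s : S) : |h s - ∑ u, q u * h u| ≤ M := by
  have hrepr : h s - ∑ u, q u * h u = ∑ u, q u * (h s - h u) := by
    have : ∑ u, q u * (h s - h u) = (∑ u, q u) * h s - ∑ u, q u * h u := by
      rw [Finset.sum_mul, ← Finset.sum_sub_distrib]
      apply Finset.sum_congr rfl
      intro u _
      ring
    rw [this, hq1, one_mul]
  rw [hrepr, abs_le]
  constructor
  · have : -M = ∑ u, q u * (-M) := by rw [← Finset.sum_mul, hq1, one_mul]
    rw [this]
    apply Finset.sum_le_sum
    intro u _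
    apply mul_le_mul_of_nonneg_left _ (hq0 u)
    have := hM u s
    linarith
  · have : M = ∑ u, q u * M := by rw [← Finset.sum_mul, hq1, one_mul]
    rw [this]
    apply Finset.sum_le_sum
    intro u _
    exact mul_le_mul_of_nonneg_left (hM s u) (hq0 u)

/-- A covariance is at least minus the product of the two oscillation bounds. -/
theorem neg_mul_osc_le_cov {h₁ h₂ : S → ℝ} {M₁ M₂ : ℝ} (hM₁ : Osc h₁ M₁) (hM₂ : Osc h₂ M₂)
    (q : S → ℝ) (hq0 : ∀ s, 0 ≤ q s) (hq1 : ∑ s, q s = 1) : -(M₁ * M₂) ≤ cov q h₁ h₂ := by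
  rw [cov_eq_centered q h₁ h₂ hq1]
  have : -(M₁ * M₂) = ∑ s, q s * (-(M₁ * M₂)) := by rw [← Finset.sum_mul, hq1, one_mul]
  rw [this]
  apply Finset.sum_le_sum
  intro s _
  apply mul_le_mul_of_nonneg_left _ (hq0 s)
  have e1 := abs_sub_mean_le hM₁ q hq0 hq1 s
  have e2 := abs_sub_mean_le hM₂ q hq0 hq1 s
  have hM₁0 : 0 ≤ M₁ := le_trans (abs_nonneg _) e1
  have hM₂0 : 0 ≤ M₂ := le_trans (abs_nonneg _) e2
  have habs : |(h₁ s - ∑ u, q u * h₁ u) * (h₂ s - ∑ u, q u * h₂ u)| ≤ M₁ * M₂ := by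
    rw [abs_mul]
    exact mul_le_mul e1 e2 (abs_nonneg _) hM₁0
  exact (abs_le.mp habs).1

/-- Any function has oscillation at most twice the sum of its absolute values. -/
theorem osc_two_sum_abs (g : S → ℝ) : Osc g (2 * ∑ s, |g s|) := by
  intro s s'
  have h1 : |g s| ≤ ∑ u, |g u| :=
    Finset.single_le_sum (fun u _ => abs_nonneg (g u)) (Finset.mem_univ s)
  have h2 : |g s'| ≤ ∑ u, |g u| :=
    Finset.single_le_sum (fun u _ => abs_nonneg (g u)) (Finset.mem_univ s')
  have := abs_sub (g s) (g s')
  have h3 : g s - g s' ≤ |g s - g s'| := le_abs_self _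
  linarith

/-- The Doeblin contraction: a kernel with all entries `≥ δ` contracts the oscillation by the
factor `1 − δ·|S|`. -/
theorem osc_kap [Nonempty S] {T : S → S → ℝ} {δ : ℝ} (hTδ : ∀ s u, δ ≤ T s u)
    (hT1 : ∀ s, ∑ u, T s u = 1) {h : S → ℝ} {M : ℝ} (hM : Osc h M) :
    Osc (kap T h) ((1 - δ * (Fintype.card S : ℝ)) * M) := by
  intro s s'
  obtain ⟨u₀, -, hu₀⟩ := Finset.exists_max_image (Finset.univ : Finset S) h Finset.univ_nonempty
  obtain ⟨v₀, -, hv₀⟩ := Finset.exists_min_image (Finset.univ : Finset S) h Finset.univ_nonempty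
  set ρ := 1 - δ * (Fintype.card S : ℝ) with hρ
  have hsum : ∀ t, ∑ u, (T t u - δ) = ρ := by
    intro t
    rw [Finset.sum_sub_distrib, hT1 t, Finset.sum_const, Finset.card_univ, nsmul_eq_mul, hρ]
    ring
  have hnn : ∀ t u, 0 ≤ T t u - δ := fun t u => sub_nonneg.mpr (hTδ t u)
  -- `kap T h t = ∑ u, (T t u - δ) * h u + δ * ∑ u, h u`
  have hkap : ∀ t, kap T h t = (∑ u, (T t u - δ) * h u) + δ * ∑ u, h u := by
    intro t
    unfold kap
    rw [Finset.mul_sum, ← Finset.sum_add_distrib]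
    apply Finset.sum_congr rfl
    intro u _
    ring
  have hup : ∑ u, (T s u - δ) * h u ≤ ρ * h u₀ := by
    rw [← hsum s, Finset.sum_mul]
    apply Finset.sum_le_sum
    intro u _
    exact mul_le_mul_of_nonneg_left (hu₀ u (Finset.mem_univ u)) (hnn s u)
  have hlow : ρ * h v₀ ≤ ∑ u, (T s' u - δ) * h u := by
    rw [← hsum s', Finset.sum_mul]
    apply Finset.sum_le_sum
    intro u _
    exact mul_le_mul_of_nonneg_left (hv₀ u (Finset.mem_univ u)) (hnn s' u)
  have hρ0 : 0 ≤ ρ := by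
    rw [← hsum s]
    exact Finset.sum_nonneg (fun u _ => hnn s u)
  have hosc : h u₀ - h v₀ ≤ M := hM u₀ v₀
  have : ρ * (h u₀ - h v₀) ≤ ρ * M := mul_le_mul_of_nonneg_left hosc hρ0
  rw [hkap s, hkap s']
  linarith [mul_sub ρ (h u₀) (h v₀)]

/-- Iterates of the kernel keep the class and contract the oscillation bound geometrically. -/
theorem osc_iterate [Nonempty S] {T : S → S → ℝ} {δ : ℝ} (hTδ : ∀ s u, δ ≤ T s u)
    (hT1 : ∀ s, ∑ u, T s u = 1) {g : S → ℝ} {M : ℝ} (hM : Osc g M) (n : ℕ) :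
    Osc ((kap T)^[n] g) ((1 - δ * (Fintype.card S : ℝ)) ^ n * M) := by
  induction n with
  | zero => simpa using hM
  | succ n ih =>
    rw [Function.iterate_succ_apply', pow_succ]
    have := osc_kap hTδ hT1 ih
    rw [show (1 - δ * (Fintype.card S : ℝ)) ^ n * (1 - δ * (Fintype.card S : ℝ)) * M
        = (1 - δ * (Fintype.card S : ℝ)) * ((1 - δ * (Fintype.card S : ℝ)) ^ n * M) by ring]
    exact this

/-- The covariance-decrease step, iterated. -/
theorem cov_iterate_le (q : S → ℝ) (T : S → S → ℝ) (Inc : (S → ℝ) → Prop)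
    (hIncT : ∀ g, Inc g → Inc (kap T g))
    (hdec : ∀ g₁ g₂, Inc g₁ → Inc g₂ → cov q (kap T g₁) (kap T g₂) ≤ cov q g₁ g₂)
    (g₁ g₂ : S → ℝ) (h₁ : Inc g₁) (h₂ : Inc g₂) (n : ℕ) :
    Inc ((kap T)^[n] g₁) ∧ Inc ((kap T)^[n] g₂) ∧
      cov q ((kap T)^[n] g₁) ((kap T)^[n] g₂) ≤ cov q g₁ g₂ := by
  induction n with
  | zero => exact ⟨h₁, h₂, le_rfl⟩
  | succ n ih =>
    obtain ⟨i₁, i₂, hc⟩ := ih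
    refine ⟨?_, ?_, ?_⟩
    · rw [Function.iterate_succ_apply']; exact hIncT _ i₁
    · rw [Function.iterate_succ_apply']; exact hIncT _ i₂
    · rw [Function.iterate_succ_apply', Function.iterate_succ_apply']
      exact le_trans (hdec _ _ i₁ i₂) hc

/-- **Positive association from a monotone Gibbs sampler.** `q` a probability vector on the finite
type `S`; `T` a stochastic kernel with all entries `≥ δ > 0`; `Inc` a class of functions closed
under `T` on which one step does not increase the covariance.  Then the covariance of any two
functions of the class is non-negative. -/
theorem cov_nonneg_of_gibbs [Nonempty S] (q : S → ℝ) (hq0 : ∀ s, 0 ≤ q s) (hq1 : ∑ s, q s = 1)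
    (T : S → S → ℝ) (δ : ℝ) (hδ : 0 < δ) (hTδ : ∀ s u, δ ≤ T s u) (hT1 : ∀ s, ∑ u, T s u = 1)
    (Inc : (S → ℝ) → Prop) (hIncT : ∀ g, Inc g → Inc (kap T g))
    (hdec : ∀ g₁ g₂, Inc g₁ → Inc g₂ → cov q (kap T g₁) (kap T g₂) ≤ cov q g₁ g₂)
    (g₁ g₂ : S → ℝ) (h₁ : Inc g₁) (h₂ : Inc g₂) : 0 ≤ cov q g₁ g₂ := by
  set ρ := 1 - δ * (Fintype.card S : ℝ) with hρ
  -- `0 ≤ ρ < 1`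
  have hN : (0 : ℝ) < Fintype.card S := by exact_mod_cast Fintype.card_pos
  have hρ1 : ρ < 1 := by
    rw [hρ]
    have : 0 < δ * (Fintype.card S : ℝ) := mul_pos hδ hN
    linarith
  have hρ0 : 0 ≤ ρ := by
    obtain ⟨s₀⟩ := (inferInstance : Nonempty S)
    have h1 : ∑ u, δ ≤ ∑ u, T s₀ u := Finset.sum_le_sum (fun u _ => hTδ s₀ u)
    rw [hT1 s₀, Finset.sum_const, Finset.card_univ, nsmul_eq_mul] at h1
    rw [hρ]
    linarith
  set M₁ := 2 * ∑ s, |g₁ s| with hM₁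
  set M₂ := 2 * ∑ s, |g₂ s| with hM₂
  have hM₁0 : 0 ≤ M₁ := by
    rw [hM₁]; exact mul_nonneg (by norm_num) (Finset.sum_nonneg (fun s _ => abs_nonneg _))
  have hM₂0 : 0 ≤ M₂ := by
    rw [hM₂]; exact mul_nonneg (by norm_num) (Finset.sum_nonneg (fun s _ => abs_nonneg _))
  have key : ∀ n : ℕ, -(ρ ^ n * M₁ * (ρ ^ n * M₂)) ≤ cov q g₁ g₂ := by
    intro n
    obtain ⟨-, -, hc⟩ := cov_iterate_le q T Inc hIncT hdec g₁ g₂ h₁ h₂ n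
    have o₁ := osc_iterate hTδ hT1 (osc_two_sum_abs g₁) n
    have o₂ := osc_iterate hTδ hT1 (osc_two_sum_abs g₂) n
    rw [← hρ, ← hM₁] at o₁
    rw [← hρ, ← hM₂] at o₂
    exact le_trans (neg_mul_osc_le_cov o₁ o₂ q hq0 hq1) hc
  by_contra hneg
  have hneg' : cov q g₁ g₂ < 0 := not_le.mp hneg
  set ε := -cov q g₁ g₂ with hε
  have hε0 : 0 < ε := by rw [hε]; linarith
  have hpos : 0 < ε / (M₁ * M₂ + 1) := by
    apply div_pos hε0
    have := mul_nonneg hM₁0 hM₂0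
    linarith
  obtain ⟨n, hn⟩ := exists_pow_lt_of_lt_one hpos hρ1
  have hρn0 : 0 ≤ ρ ^ n := pow_nonneg hρ0 n
  have hρn1 : ρ ^ n ≤ 1 := pow_le_one₀ hρ0 (le_of_lt hρ1)
  have hbound : ρ ^ n * M₁ * (ρ ^ n * M₂) ≤ ρ ^ n * (M₁ * M₂) := by
    have : ρ ^ n * M₁ * (ρ ^ n * M₂) = (ρ ^ n * ρ ^ n) * (M₁ * M₂) := by ring
    rw [this]
    apply mul_le_mul_of_nonneg_right _ (mul_nonneg hM₁0 hM₂0)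
    calc ρ ^ n * ρ ^ n ≤ ρ ^ n * 1 := mul_le_mul_of_nonneg_left hρn1 hρn0
      _ = ρ ^ n := mul_one _
  have hsmall : ρ ^ n * (M₁ * M₂) < ε := by
    have hM12 : M₁ * M₂ < M₁ * M₂ + 1 := by linarith
    have hM120 : 0 ≤ M₁ * M₂ := mul_nonneg hM₁0 hM₂0
    calc ρ ^ n * (M₁ * M₂) ≤ (ε / (M₁ * M₂ + 1)) * (M₁ * M₂) :=
          mul_le_mul_of_nonneg_right (le_of_lt hn) hM120
      _ < (ε / (M₁ * M₂ + 1)) * (M₁ * M₂ + 1) := by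
          apply mul_lt_mul_of_pos_left hM12 hpos
      _ = ε := by field_simp
  have := key n
  linarith

end GibbsPA

end Summit.Ventures.PercRepro2
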